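import Literature.Probability.LatticeModels.EdgeFirstExit
import Literature.Probability.LatticeModels.GermRegionLattice
import HarnessLib

/-!
# Deaths of the edge-killed walk away from the inner box land on the lateral arcs

Sub-problem `CriticalPhenomena/SAWScalingLimit`, crux `AvoidanceLimit`
(`Summit.CriticalPhenomena.SAWScalingLimit.Theses.SAWLoopFugacityFlow.AvoidanceLimit`,
stmt-CriticalPhenomena-10649), line `symplectic-fermion-anchor`, stub W18.

Let `D` be a Jordan domain, `b` a centre, `0 < s < s'` two scales, `g ∈ D ∩ box b s` a base point
and `o ∈ D` a far point off the closed box of radius `s'`; let `U = germRegion D b hs g o ⊆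
U' = germRegion D b hs' g o` be the inner and outer germ regions (`GermRegions.lean`, the regions
`Ω_o(b,r)` of Chelkak–Wan 2021, §3.2, with boxes for discs), with frontiers
`frontier U' = gateArc' ∪ ∂D[σ', τ']` and `frontier U = gateArc ∪ ∂D[θ₁, θ₂]`,
`σ' < θ₁ < θ₂ < τ' < σ' + 1` (the output of `exists_nested_germArcs`). On the mesh `δℤ²` let `y` be
a site of `Θ_δ(s') = germSites D b hs' g o δ` off `Θ_δ(s)`, whose mesh point is off the closed box
of radius `s + 2δ` and at distance `> 2δ` from the outer gate arc, and let `y → y + e` be a lattice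
edge that is not an edge of `Ω_δ`. We prove (`edgeLanding_mem_lateral`) that its landing point
(`edgeLanding`, the first exit point of the segment `[δy, δ(y + e)]` from `D`,
`EdgeFirstExit.lean`) lies on one of the two *lateral* arcs `∂D[σ', θ₁]`, `∂D[θ₂, τ']`.

Proof. The initial open sub-segment `L₀` before the landing point `q` is a preconnected subset of
`D` through `p = δy ∈ U'`, within `δ` of `p`, hence off the outer gate: so `L₀ ⊆ U'`
(`subset_gateSide_of_isPreconnected`), `q ∈ closure U' ∖ U' = frontier U'`, and `q` is off the
outer gate arc, so `q = D.boundary θ` with `θ ∈ [σ', τ']`. If `θ ∈ [θ₁, θ₂]` then `q ∈ closure U`;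
but `L₀` misses the inner gate (sup-norm bookkeeping: `p` is off the box of radius `s + 2δ`) and
`p ∉ U`, so `L₀` lies in the inner far side and `q` in its closure; the closures of the two inner
sides meet only along the inner gate arc (`closure_gateSide_inter_closure_gateFar`), which lies on
the square of radius `s` — again excluded by the sup-norm bookkeeping. Everything is elementary
plane topology on top of Newman's cross-cut theorem (through `GermRegions`/`LoopGates`).

## References
* D. Chelkak, Y. Wan, *On the convergence of massive loop-erased random walks to massive SLE(2)
  curves*, Electron. J. Probab. 26 (2021), §3.2. [ChelkakWan2021]
* M. H. A. Newman, *Elements of the topology of plane sets of points*, Cambridge Univ. Press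
  (1939), Ch. V §11. [Newman1939]
-/

noncomputable section

open scoped BigOperators Classical
open Set Metric Filter Topology
open Literature.Topology.PlaneTopology
open Literature.Probability.LatticeModels
open Literature.Probability.RandomPlanarGeometry (JordanDomain)

namespace Summit.CriticalPhenomena.SAWScalingLimit.Theorems.AvoidanceLimit.Anchor

/-- Sup-norm bookkeeping: a point whose coordinates are within `δ` of those of a point off the
closed box of radius `s + 2δ` is off the closed box of radius `s`. [folklore] -/
theorem not_mem_closedBox_of_abs_sub_le_of_not_mem {b p z : ℂ} {s δ : ℝ} (hδ : 0 ≤ δ)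
    (hp : p ∉ closedBox b (s + 2 * δ)) (hz : |z.re - p.re| ≤ δ ∧ |z.im - p.im| ≤ δ) :
    z ∉ closedBox b s := by
  intro hzb
  rw [mem_closedBox] at hzb
  obtain ⟨h1, h2⟩ := hz
  rw [abs_le] at h1 h2
  exact hp (mem_closedBox.2 ⟨by linarith, by linarith, by linarith, by linarith⟩)

/-- **Deaths away from the inner box land on the lateral arcs.** In the setting of the module
docstring (inner/outer germ regions with nested boundary arcs `σ' < θ₁ < θ₂ < τ' < σ' + 1`), for a
site `y ∈ Θ_δ(s') ∖ Θ_δ(s)` whose mesh point is off `closedBox b (s + 2δ)` and at distance `> 2δ`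
from the outer gate arc, the landing point of every lattice edge `y → y + e` that is not an edge of
`Ω_δ` lies on `∂D[σ', θ₁] ∪ ∂D[θ₂, τ']`. [cite: ChelkakWan2021, §3.2] -/
theorem edgeLanding_mem_lateral :
    ∀ (D : JordanDomain) (b : ℂ) (s s' : ℝ) (hs : 0 < s) (hs' : 0 < s'), s < s' → ∀ (g o : ℂ),
      TwoOff D (boxJD b hs) → TwoOff D (boxJD b hs') →
      g ∈ D.carrier ∩ Literature.Topology.PlaneTopology.box b s → o ∈ D.carrier → o ∉ closedBox b s' →
      ∀ (σ' θ₁ θ₂ τ' : ℝ), σ' < θ₁ → θ₁ < θ₂ → θ₂ < τ' → τ' < σ' + 1 →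
      frontier (germRegion D b hs' g o) =
        gateArc D (boxJD b hs') (germGateParam D b hs' g o) ∪ D.boundary '' Set.Icc σ' τ' →
      frontier (germRegion D b hs g o) =
        gateArc D (boxJD b hs) (germGateParam D b hs g o) ∪ D.boundary '' Set.Icc θ₁ θ₂ →
      ({D.boundary θ₁, D.boundary θ₂} : Set ℂ) =
        {(boxJD b hs).boundary (gateLo D (boxJD b hs) (germGateParam D b hs g o)),
         (boxJD b hs).boundary (gateHi D (boxJD b hs) (germGateParam D b hs g o))} →
      ∀ (δ : ℝ), 0 < δ → ∀ y ∈ germSites D b hs' g o δ, y ∉ germSites D b hs g o δ →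
        meshPoint δ y ∉ closedBox b (s + 2 * δ) →
        (∀ z ∈ gateArc D (boxJD b hs') (germGateParam D b hs' g o), 2 * δ < dist (meshPoint δ y) z) →
        ∀ e : SRW.Dir 2, ¬ (discreteDomainGraph D.carrier δ).Adj y (y + SRW.stepVec e) →
          edgeLanding D.carrier δ y e ∈ D.boundary '' Set.Icc σ' θ₁ ∪ D.boundary '' Set.Icc θ₂ τ' := by
  intro D b s s' hs hs' hss' g o h2 h2' hg ho hoc σ' θ₁ θ₂ τ' _h₁ _h₂ _h₃ _h₄ hfU' hfU _hends δ hδ y hy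
    hyU hpbox hfar e hadj
  have hoc_s : o ∉ closedBox b s := fun h => hoc (closedBox_mono hss'.le h)
  -- the edge `[p, p']`, its landing point `q` and first exit parameter `tstar`
  set p : ℂ := meshPoint δ y
  set p' : ℂ := meshPoint δ (y + SRW.stepVec e)
  set q : ℂ := edgeLanding D.carrier δ y e
  set tstar : ℝ := firstExitParam D.carrier p p'
  have hym : y ∈ meshDomain D.carrier δ := hy.1
  have hpU' : p ∈ germRegion D b hs' g o := hy.2
  have hpU : p ∉ germRegion D b hs g o := fun h => hyU ⟨hym, h⟩
  have hpD : p ∈ D.carrier := meshDomain_subset_meshVertices _ _ hym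
  have hseg : ¬ segment ℝ p p' ⊆ D.carrier :=
    not_segment_subset_of_not_discreteDomainGraph_adj hym (zdGraph_adj_add_stepVec y e) hadj
  have htpos : 0 < tstar := firstExitParam_pos D.isOpen hpD hseg
  have hqfr : q ∈ frontier D.carrier := edgeLanding_mem_frontier_of_not_adj D.isOpen hym hadj
  have hqD : q ∉ D.carrier := fun h => by
    have hmem : q ∈ D.carrier ∩ frontier D.carrier := ⟨h, hqfr⟩
    rw [D.isOpen.inter_frontier_eq] at hmem
    exact hmem
  -- the edge has length `δ`: the closed segment lies in the closed `δ`-ball about `p`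
  have hpp' : dist p p' = δ := (dist_meshPoint_add_stepVec δ y e).trans (abs_of_pos hδ)
  have hsegball : segment ℝ p p' ⊆ closedBall p δ :=
    (convex_closedBall p δ).segment_subset (mem_closedBall_self hδ.le)
      (mem_closedBall.2 ((dist_comm p' p).trans hpp').le)
  have hqseg : q ∈ segment ℝ p p' := edgeLanding_mem_segment
  have hpq : dist p q ≤ δ := dist_meshPoint_edgeLanding_le hδ.le
  -- (i) the initial open sub-segment `L₀` before the landing point
  set L₀ : Set ℂ := (AffineMap.lineMap p p' : ℝ →ᵃ[ℝ] ℂ) '' Ico (0 : ℝ) tstar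
  have hL₀D : L₀ ⊆ D.carrier := by
    rintro _ ⟨t, ht, rfl⟩
    exact lineMap_mem_of_lt_firstExitParam ht
  have hL₀seg : L₀ ⊆ segment ℝ p p' := by
    rintro _ ⟨t, ht, rfl⟩
    rw [segment_eq_image_lineMap ℝ p p']
    exact ⟨t, ⟨ht.1, ht.2.le.trans firstExitParam_le_one⟩, rfl⟩
  have hL₀pc : IsPreconnected L₀ :=
    isPreconnected_Ico.image _ AffineMap.lineMap_continuous.continuousOn
  have hpL₀ : p ∈ L₀ := ⟨0, ⟨le_rfl, htpos⟩, AffineMap.lineMap_apply_zero p p'⟩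
  have hqL₀ : q ∈ closure L₀ := by
    have hmem : tstar ∈ closure (Ico (0 : ℝ) tstar) := by
      rw [closure_Ico htpos.ne]
      exact right_mem_Icc.2 htpos.le
    exact image_closure_subset_closure_image AffineMap.lineMap_continuous ⟨tstar, hmem, rfl⟩
  -- (ii) `L₀ ⊆ U'`, so `q ∈ frontier U'` off the outer gate arc: `q = D.boundary θ`, `θ ∈ [σ', τ']`
  have hL₀U' : L₀ ⊆ germRegion D b hs' g o := by
    have hsub : L₀ ⊆ D.carrier \ gate D (boxJD b hs') (germGateParam D b hs' g o) := fun z hz =>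
      ⟨hL₀D hz, fun hzg => by
        have h1 : 2 * δ < dist p z := hfar z (gate_subset_gateArc _ hzg)
        have h2 : dist z p ≤ δ := hsegball (hL₀seg hz)
        rw [dist_comm] at h2
        linarith⟩
    exact subset_gateSide_of_isPreconnected hL₀pc hsub ⟨p, hpL₀, hpU'⟩
  have hqfrU' : q ∈ frontier (germRegion D b hs' g o) :=
    ⟨closure_mono hL₀U' hqL₀, fun h => hqD (germRegion_subset_carrier (interior_subset h))⟩
  rw [hfU'] at hqfrU'
  obtain ⟨θ, hθ, hθq⟩ : q ∈ D.boundary '' Icc σ' τ' := by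
    rcases hqfrU' with h | h
    · have := hfar q h
      linarith
    · exact h
  -- (iii) `θ ∉ [θ₁, θ₂]`: else `q ∈ closure U ∩ closure (germFar U) ⊆ gateArc ⊆ closedBox b s`
  have hθno : θ ∉ Icc θ₁ θ₂ := fun hθ₁₂ => by
    have hqclU : q ∈ closure (germRegion D b hs g o) := by
      refine frontier_subset_closure ?_
      rw [hfU]
      exact Or.inr ⟨θ, hθ₁₂, hθq⟩
    have hcover : L₀ ⊆ germRegion D b hs g o ∪ germFar D b hs g o := by
      rw [germRegion_union_germFar]
      exact fun z hz => ⟨hL₀D hz, fun hzg => not_mem_closedBox_of_abs_sub_le_of_not_mem hδ.le hpbox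
        (abs_re_sub_le_of_mem_segment hδ.le e (hL₀seg hz)) (germGate_subset_square hzg).1⟩
    have hL₀far : L₀ ⊆ germFar D b hs g o := by
      rcases hL₀pc.subset_or_subset (isOpen_germRegion h2 hg ho hoc_s) (isOpen_germFar h2 hg ho hoc_s)
        disjoint_germRegion_germFar hcover with h | h
      · exact absurd (h hpL₀) hpU
      · exact h
    have hqarc : q ∈ gateArc D (boxJD b hs) (germGateParam D b hs g o) :=
      closure_gateSide_inter_closure_gateFar h2 (germGateParam_spec h2 hg ho hoc_s).1
        (base_not_mem_gate hs hg _) ⟨hqclU, closure_mono hL₀far hqL₀⟩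
    obtain ⟨φ, -, hφ⟩ := hqarc
    exact not_mem_closedBox_of_abs_sub_le_of_not_mem hδ.le hpbox
      (abs_re_sub_le_of_mem_segment hδ.le e hqseg) (hφ ▸ (boundary_boxJD_mem b hs φ).1)
  -- (iv) conclude
  rcases le_or_gt θ θ₁ with h₁ | h₁
  · exact Or.inl ⟨θ, ⟨hθ.1, h₁⟩, hθq⟩
  rcases le_or_gt θ₂ θ with h₂ | h₂
  · exact Or.inr ⟨θ, ⟨h₂, hθ.2⟩, hθq⟩
  exact absurd ⟨h₁.le, h₂.le⟩ hθno

end Summit.CriticalPhenomena.SAWScalingLimit.Theorems.AvoidanceLimit.Anchor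

end
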